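import Literature.Analysis.FluidPDE.StatisticalSolutionDirac

/-!
# Finitely atomic laws on the energy space: averages of Dirac masses

Helper file for stub S6 (`stub_order2Design`) of the line `recession-cone` of crux
`MomentParity.QuarticGate`. The order-2 design is the UNIFORM law on a finite family of atoms
`U : ι → H`, i.e. the measure `(#ι)⁻¹ • ∑ᵢ δ_{U i}` on the energy space `H`. This file records the
finite-average calculus of such laws: probability, almost-everywhere statements, integrability,
`∫ F dμ = (#ι)⁻¹ ∑ᵢ F (U i)`, `∫⁻ G dμ = (#ι)⁻¹ ∑ᵢ G (U i)`, the mean energy / enstrophy /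
dissipation, and the strict Cauchy–Schwarz (variance) inequality `(avg p)² < avg p²` as soon as two
atoms carry different values — the source of the NONDEGENERATE COVARIANCE clause.
-/

namespace Summit.AnomalousDissipation.AnomalousDissipation.Theorems.MomentParityQuarticGate

open MeasureTheory Filter
open scoped ENNReal
open Literature.Analysis.FunctionSpaces Literature.Analysis.FluidPDE

set_option linter.dupNamespace false

section Average

variable {ι : Type*} [Fintype ι] [Nonempty ι] (U : ι → Torus.energySpace (Fin 3))

/-- The number of atoms, as an extended non-negative real, is neither `0` nor `∞`. [folklore] -/
theorem card_ne_zero_ennreal : ((Fintype.card ι : ℝ≥0∞)) ≠ 0 ∧ ((Fintype.card ι : ℝ≥0∞)) ≠ ∞ :=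
  ⟨by exact_mod_cast Fintype.card_ne_zero, ENNReal.natCast_ne_top _⟩

/-- **The uniform law on finitely many atoms is a probability measure.** [folklore] -/
theorem isProbabilityMeasure_average :
    IsProbabilityMeasure (((Fintype.card ι : ℝ≥0∞))⁻¹ • ∑ i, Measure.dirac (U i)) := by
  refine ⟨?_⟩
  rw [Measure.smul_apply, Measure.finsetSum_apply, smul_eq_mul]
  simp only [measure_univ, Finset.sum_const, Finset.card_univ, nsmul_eq_mul, mul_one]
  exact ENNReal.inv_mul_cancel card_ne_zero_ennreal.1 card_ne_zero_ennreal.2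

omit [Nonempty ι] in
/-- **Almost-everywhere statements for the uniform law** follow from the statement at each atom.
[folklore] -/
theorem ae_average {p : Torus.energySpace (Fin 3) → Prop} (h : ∀ i, p (U i)) :
    ∀ᵐ u ∂(((Fintype.card ι : ℝ≥0∞))⁻¹ • ∑ i, Measure.dirac (U i)), p u := by
  haveI : MeasurableSingletonClass (Torus.energySpace (Fin 3)) :=
    OpensMeasurableSpace.toMeasurableSingletonClass
  refine Measure.ae_smul_measure ?_ _
  rw [ae_iff, Measure.finsetSum_apply]
  refine Finset.sum_eq_zero fun i _ => ?_
  rw [Measure.dirac_apply, Set.indicator_of_notMem]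
  exact fun hi => hi (h i)

/-- **Every real observable is integrable against the uniform law.** [folklore] -/
theorem integrable_average (F : Torus.energySpace (Fin 3) → ℝ) :
    Integrable F (((Fintype.card ι : ℝ≥0∞))⁻¹ • ∑ i, Measure.dirac (U i)) :=
  (integrable_finsetSum_measure.2 fun i _ => Torus.integrable_dirac (U i) F).smul_measure
    (ENNReal.inv_ne_top.2 card_ne_zero_ennreal.1)

omit [Nonempty ι] in
/-- **Integrals against the uniform law are finite averages**: `∫ F dμ = (#ι)⁻¹ ∑ᵢ F (U i)`.
[folklore] -/
theorem integral_average (F : Torus.energySpace (Fin 3) → ℝ) :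
    ∫ u, F u ∂(((Fintype.card ι : ℝ≥0∞))⁻¹ • ∑ i, Measure.dirac (U i)) =
      (Fintype.card ι : ℝ)⁻¹ * ∑ i, F (U i) := by
  haveI : MeasurableSingletonClass (Torus.energySpace (Fin 3)) :=
    OpensMeasurableSpace.toMeasurableSingletonClass
  rw [integral_smul_measure, integral_finsetSum_measure fun i _ => Torus.integrable_dirac (U i) F]
  simp only [integral_dirac, ENNReal.toReal_inv, ENNReal.toReal_natCast, smul_eq_mul]

omit [Nonempty ι] in
/-- **Lower integrals against the uniform law are finite averages**: `∫⁻ G dμ = (#ι)⁻¹ ∑ᵢ G (U i)`.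
[folklore] -/
theorem lintegral_average (G : Torus.energySpace (Fin 3) → ℝ≥0∞) :
    ∫⁻ u, G u ∂(((Fintype.card ι : ℝ≥0∞))⁻¹ • ∑ i, Measure.dirac (U i)) =
      ((Fintype.card ι : ℝ≥0∞))⁻¹ * ∑ i, G (U i) := by
  haveI : MeasurableSingletonClass (Torus.energySpace (Fin 3)) :=
    OpensMeasurableSpace.toMeasurableSingletonClass
  rw [lintegral_smul_measure, lintegral_finsetSum_measure]
  simp only [lintegral_dirac, smul_eq_mul]

omit [Nonempty ι] in
/-- **Mean energy of the uniform law**: `ensembleEnergy μ = (#ι)⁻¹ ∑ᵢ ‖U i‖²`. [folklore] -/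
theorem ensembleEnergy_average :
    Torus.ensembleEnergy (((Fintype.card ι : ℝ≥0∞))⁻¹ • ∑ i, Measure.dirac (U i)) =
      (Fintype.card ι : ℝ)⁻¹ * ∑ i, ‖U i‖ ^ 2 :=
  integral_average U _

omit [Nonempty ι] in
/-- **Mean dissipation of the uniform law** when every atom has finite enstrophy `e i`:
`ensembleDissipation ν μ = ν (#ι)⁻¹ ∑ᵢ e i`. [folklore] -/
theorem ensembleDissipation_average (ν : ℝ) {e : ι → ℝ} (he : ∀ i, 0 ≤ e i)
    (hU : ∀ i, Torus.eGradNormSq (((U i).1 : Lp (EuclideanSpace ℝ (Fin 3)) 2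
      (volume : Measure (UnitAddTorus (Fin 3)))) : UnitAddTorus (Fin 3) → EuclideanSpace ℝ (Fin 3)) =
        ENNReal.ofReal (e i)) :
    Torus.ensembleDissipation ν (((Fintype.card ι : ℝ≥0∞))⁻¹ • ∑ i, Measure.dirac (U i)) =
      ν * ((Fintype.card ι : ℝ)⁻¹ * ∑ i, e i) := by
  unfold Torus.ensembleDissipation Torus.ensembleEnstrophy
  rw [lintegral_average]
  simp_rw [hU]
  rw [← ENNReal.ofReal_sum_of_nonneg fun i _ => he i, ENNReal.toReal_mul, ENNReal.toReal_inv,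
    ENNReal.toReal_natCast, ENNReal.toReal_ofReal (Finset.sum_nonneg fun i _ => he i)]

/-- **Strict Cauchy–Schwarz for a finite average**: if two atoms carry different values of `p`,
then `(avg p)² < avg p²` (the variance `avg (p - avg p)²` is positive). [folklore] -/
theorem sq_average_lt_average_sq {p : ι → ℝ} (h : ∃ i j, p i ≠ p j) :
    ((Fintype.card ι : ℝ)⁻¹ * ∑ i, p i) ^ 2 < (Fintype.card ι : ℝ)⁻¹ * ∑ i, p i ^ 2 := by
  set n : ℝ := (Fintype.card ι : ℝ) with hn
  have hn0 : 0 < n := by rw [hn]; exact_mod_cast Fintype.card_pos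
  set m : ℝ := n⁻¹ * ∑ i, p i with hm
  -- some atom deviates from the mean
  obtain ⟨i₀, hi₀⟩ : ∃ i, p i ≠ m := by
    by_contra hall
    push Not at hall
    obtain ⟨i, i', hii'⟩ := h
    exact hii' ((hall i).trans (hall i').symm)
  have hvar : 0 < ∑ i, (p i - m) ^ 2 :=
    Finset.sum_pos' (fun i _ => sq_nonneg _) ⟨i₀, Finset.mem_univ _, by positivity⟩
  have hsum : ∑ i, p i = n * m := by
    rw [hm, ← mul_assoc, mul_inv_cancel₀ hn0.ne', one_mul]
  have hexp : ∑ i, (p i - m) ^ 2 = ∑ i, p i ^ 2 - n * m ^ 2 := by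
    have : ∑ i, (p i - m) ^ 2 = ∑ i, p i ^ 2 - 2 * m * ∑ i, p i + ∑ _i : ι, m ^ 2 := by
      rw [Finset.mul_sum, ← Finset.sum_sub_distrib, ← Finset.sum_add_distrib]
      exact Finset.sum_congr rfl fun i _ => by ring
    rw [this, hsum, Finset.sum_const, Finset.card_univ, nsmul_eq_mul, ← hn]
    ring
  rw [hexp] at hvar
  have key : m ^ 2 < n⁻¹ * ∑ i, p i ^ 2 := by
    rw [lt_inv_mul_iff₀ hn0]
    linarith
  exact key

/-- **Nondegeneracy of the uniform law from two distinct atom values**: for the uniform law `μ`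
and an observable `F` taking different values at two atoms, `(∫ F dμ)² < ∫ F² dμ`. [folklore] -/
theorem sq_integral_lt_integral_sq_average (F : Torus.energySpace (Fin 3) → ℝ)
    (h : ∃ i i', F (U i) ≠ F (U i')) :
    (∫ u, F u ∂(((Fintype.card ι : ℝ≥0∞))⁻¹ • ∑ i, Measure.dirac (U i))) ^ 2 <
      ∫ u, F u ^ 2 ∂(((Fintype.card ι : ℝ≥0∞))⁻¹ • ∑ i, Measure.dirac (U i)) := by
  rw [integral_average, integral_average U fun u => F u ^ 2]
  exact sq_average_lt_average_sq h

omit [Nonempty ι] in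
/-- **Bounded support of the uniform law**: `‖u‖ ≤ ∑ᵢ ‖U i‖` almost surely. [folklore] -/
theorem ae_norm_le_average :
    ∀ᵐ u ∂(((Fintype.card ι : ℝ≥0∞))⁻¹ • ∑ i, Measure.dirac (U i)), ‖u‖ ≤ ∑ i, ‖U i‖ :=
  ae_average U fun i => Finset.single_le_sum (f := fun i' => ‖U i'‖) (fun _ _ => norm_nonneg _)
    (Finset.mem_univ i)

end Average

/-- **Registered sub-goal `atomicMeasure_sq_integral_lt` of stub S6** (summary of this file): for
the uniform law on finitely many atoms of the energy space, an observable taking two different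
values at two atoms has `(∫ F dμ)² < ∫ F² dμ`. [folklore] -/
theorem atomicMeasure_sq_integral_lt : ∀ (n : ℕ) (U : Fin (n + 1) → Torus.energySpace (Fin 3)) (F : Torus.energySpace (Fin 3) → ℝ), (∃ i i', F (U i) ≠ F (U i')) → (∫ u, F u ∂(((n + 1 : ℕ) : ENNReal)⁻¹ • ∑ i, Measure.dirac (U i))) ^ 2 < ∫ u, F u ^ 2 ∂(((n + 1 : ℕ) : ENNReal)⁻¹ • ∑ i, Measure.dirac (U i)) := by
  intro n U F h
  have := sq_integral_lt_integral_sq_average U F h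
  rwa [Fintype.card_fin] at this

end Summit.AnomalousDissipation.AnomalousDissipation.Theorems.MomentParityQuarticGate
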